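import Literature.Topology.FourManifolds.SPC4HandlesLeaves
import Literature.Topology.FourManifolds.SPC4HandlesNormHolds
import Literature.Topology.FourManifolds.OneHandleStepExists
import HarnessLib

/-!
# THMAᴹ in universe `0` suffices: the `ULift` bridge for the orientation-preserving case of
# Laudenbach–Poénaru's Théorème A

Topic `Literature/Topology/FourManifolds`; fact seat
`provefact-Literature.Topology.FourManifolds.laudenbachPoenaru_diffeoExtends_of_isOrientationPreserving`
(h₂ of `SPC4HandlesProofs.lean`: an orientation-preserving, based, `π₁`-trivial
self-diffeomorphism of the boundary of a compact connected orientable `4`-dimensional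
`1`-handlebody `V` extends over `V`; Laudenbach–Poénaru (1972), §2, proof of Thm. A,
pp. 341–342, "mark that no diffeomorphism of `X_p` was needed here!").

The tree reduces h₂ (every universe `u`) to NORM, UNIQ₄ and the model case THMAᴹ
(`exists_oneHandlebody_laudenbachPoenaru_diffeoExtends_of_isOrientationPreserving.{u}`,
`laudenbachPoenaru_diffeoExtends_of_isOrientationPreserving_of_model`,
`SPC4HandlesModelReduction.lean`), and NORM, UNIQ₄ to Milnor's Thm. 5.4 on a slab and the
one-`1`-handle uniqueness L1 (`SPC4HandlesLeaves.lean`).  The models of the tree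
(`{q(x, y) + z² + w² ≤ c} ⊂ ℝ⁴`, `ThickenedHandlebodyFour.lean`, `OneHandlebodySymmFour.lean`)
live in universe `0`, so a proof of THMAᴹ will first be a proof of THMAᴹ`.{0}`.  This file
supplies, once and for all, the bridge from universe `0` to every universe — the exact analogue
for THMAᴹ of `exists_oneHandlebody_diffeoExtends_isOrientationReversing_holds`
(`SPC4HandlesSymmHolds.lean`, SYMMᴹ) — so that **h₂ in every universe follows from Thm. 5.4 on a
slab, L1 and THMAᴹ in universe `0`**
(`laudenbachPoenaru_diffeoExtends_of_isOrientationPreserving_of_leaves`).  The direction of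
transport is opposite to the SYMMᴹ bridge: there a witness `ρ₀` is pushed up along
`ULift ∂V₀ ≅ ∂V₀`; here an arbitrary diffeomorphism `ψ₁` of `ULift ∂V₀` is pulled *down* to
`ψ₀ = down ∘ ψ₁ ∘ up`, its hypotheses are transported (orientation character:
`Diffeomorph.isOrientationPreserving_conj_of_forall`; fixed point; action on `π₁`:
`FundamentalGroup.mapOfEq_conj` along `Homeomorph.ulift`), THMAᴹ`.{0}` extends `ψ₀` over `V₀`,
and the extension is pushed up again (`BoundaryData.DiffeoExtends.ulift`), where
`up ∘ ψ₀ ∘ down = ψ₁`.  Everything here is **proved**; no named fact is introduced.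

## Main statements

* `Diffeomorph.isOrientationPreserving_conj_of_forall`: a conjugate `e ∘ ψ ∘ e⁻¹` of a
  diffeomorphism `ψ` preserving every smooth orientation preserves every smooth orientation
  (general universes; the in-universe form is `isOrientationPreserving_conj` of
  `SPC4HandlesModelReduction.lean`).
* `exists_oneHandlebody_laudenbachPoenaru_diffeoExtends_of_isOrientationPreserving_ulift`:
  THMAᴹ`.{0}` implies THMAᴹ`.{u}`.
* `laudenbachPoenaru_diffeoExtends_of_isOrientationPreserving_of_model_zero`,
  `laudenbachPoenaru_diffeoExtends_of_isOrientationPreserving_of_leaves`: h₂`.{u}` from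
  NORM`.{u}`, UNIQ₄`.{u}` (resp. Thm. 5.4 on a slab and L1) and THMAᴹ`.{0}`.
* `exists_diffeomorph_comp_incl_eq_of_leaves_zero`: the same economy for the full
  Laudenbach–Poénaru extension fact `exists_diffeomorph_comp_incl_eq`.
* §4 (NORM being discharged, `exists_hasHandleDecomposition_handleCount_one_holds`,
  `SPC4HandlesNormHolds.lean`):
  `laudenbachPoenaru_diffeoExtends_of_isOrientationPreserving_of_uniq_of_model_zero` (h₂`.{u}`
  from UNIQ₄`.{u}` and THMAᴹ`.{0}`),
  `laudenbachPoenaru_diffeoExtends_of_isOrientationPreserving_of_two_leaves` (h₂`.{u}` from its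
  **two remaining leaves**, L1`.{u}` and THMAᴹ`.{0}`) and
  `exists_diffeomorph_comp_incl_eq_of_three_leaves_zero` (the extension fact from L1, REALISE
  and THMAᴹ`.{0}`).  The discharge `laudenbachPoenaru_diffeoExtends_of_isOrientationPreserving_holds`
  is `…_of_two_leaves` applied to `oneHandle_nonempty_diffeomorph_holds` and a proof of THMAᴹ in
  universe `0`, once those land.
* §5 (converse): `exists_oneHandlebody_laudenbachPoenaru_diffeoExtends_of_isOrientationPreserving_zero_of_h₂`
  and `…_of_h₂` — h₂`.{0}` ⟹ THMAᴹ`.{0}` ⟹ THMAᴹ`.{u}` (the models `{q(x, y) + z² + w² ≤ c}` of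
  `OneHandlebodySymmFour.lean` exist in universe `0`), and
  `laudenbachPoenaru_diffeoExtends_of_isOrientationPreserving_of_oneHandle_of_zero` — with L1,
  h₂`.{0}` ⟹ h₂`.{u}`: THMAᴹ and h₂ are the same obligation modulo L1.
* §6 (L1 discharged, `oneHandle_nonempty_diffeomorph_holds`, `OneHandleStepExists.lean`): the
  equivalence is now unconditional —
  `laudenbachPoenaru_diffeoExtends_of_isOrientationPreserving_iff_oneHandlebody` (h₂`.{u}` ↔
  THMAᴹ`.{u}`), `laudenbachPoenaru_diffeoExtends_of_isOrientationPreserving_of_oneHandlebody_zero`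
  (h₂`.{u}` from THMAᴹ`.{0}` alone) and
  `laudenbachPoenaru_diffeoExtends_of_isOrientationPreserving_of_zero` (h₂`.{u}` from h₂`.{0}`):
  the discharge `laudenbachPoenaru_diffeoExtends_of_isOrientationPreserving_holds` is exactly a
  universe-`0` proof of Thm. A on the models, THMAᴹ`.{0}`, the one named fact h₂ still rests on.

## References

* F. Laudenbach, V. Poénaru, *A note on 4-dimensional handlebodies*, Bull. Soc. Math. France
  100 (1972), 337–344, §2, Lemma 3 (p. 340) and proof of Thm. A (pp. 341–342).
  [LaudenbachPoenaruBSMF1972]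
* F. Laudenbach, *Sur les 2-sphères d'une variété de dimension 3*, Ann. of Math. 97 (1973),
  57–81, §5 (5.3–5.4). [Laudenbach1973]
* M. W. Hirsch, *Differential Topology*, GTM 33 (1976), Ch. 4 §4. [HirschDT1976]
* A. Hatcher, *Algebraic Topology* (2002), §1.1, p. 34. [Hatcher2002]
-/

open scoped Manifold ContDiff Topology
open Set Function

noncomputable section

namespace Literature.Topology.FourManifolds

universe u

/-! ### §1 Conjugates of diffeomorphisms preserving every orientation -/

section ConjGeneral

variable {E H H' : Type*} [NormedAddCommGroup E] [NormedSpace ℝ E] [TopologicalSpace H]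
  [TopologicalSpace H'] {I : ModelWithCorners ℝ E H} {J : ModelWithCorners ℝ E H'}
  {X : Type*} [TopologicalSpace X] [ChartedSpace H X] [IsManifold I ∞ X]
  {Y : Type*} [TopologicalSpace Y] [ChartedSpace H' Y] [IsManifold J ∞ Y]

/-- **A conjugate of a diffeomorphism preserving every orientation preserves every
orientation.**  If `ψ` preserves every smooth orientation of `X` and `e : X ≅ Y` is a
diffeomorphism (same model vector space, arbitrary universes), then `e ∘ ψ ∘ e⁻¹` (written as
the composite `e⁻¹; ψ; e`) preserves every smooth orientation `o₀` of `Y`: `ψ` preserves the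
pull-back `e^* o₀` (`SmoothOrientation.comap`), `e⁻¹ : (Y, o₀) → (X, e^* o₀)` and
`e : (X, e^* o₀) → (Y, o₀)` preserve orientation, and orientation characters of diffeomorphisms
multiply (`Diffeomorph.IsOrientationPreserving.trans_holds`).  Hirsch, *Differential Topology*
(1976), §4.4 (general form of `isOrientationPreserving_conj` of
`SPC4HandlesModelReduction.lean`). [cite: HirschDT1976, §4.4] -/
theorem _root_.Diffeomorph.isOrientationPreserving_conj_of_forall (e : X ≃ₘ⟮I, J⟯ Y)
    {ψ : X ≃ₘ⟮I, I⟯ X} (hψ : ∀ o : SmoothOrientation I X, ψ.IsOrientationPreserving o o)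
    (o₀ : SmoothOrientation J Y) : ((e.symm.trans ψ).trans e).IsOrientationPreserving o₀ o₀ := by
  have hn : (∞ : WithTop ℕ∞) ≠ 0 := by simp
  let o := o₀.comap e hn
  have heo : e.IsOrientationPreserving o o₀ :=
    SmoothOrientation.isOrientationPreserving_comap o₀ e hn
  have hes : e.symm.IsOrientationPreserving o₀ o :=
    Diffeomorph.IsOrientationPreserving.symm_holds heo hn
  have h1 : (e.symm.trans ψ).IsOrientationPreserving o₀ o :=
    Diffeomorph.IsOrientationPreserving.trans_holds hes (hψ o) hn
  exact Diffeomorph.IsOrientationPreserving.trans_holds h1 heo hn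

end ConjGeneral

/-! ### §2 THMAᴹ lifts from universe `0` to every universe -/

/-- **THMAᴹ in universe `0` implies THMAᴹ in every universe.**  For every `p`, lift the
universe-`0` model `(V₀, b₀, z₀)` of
`exists_oneHandlebody_laudenbachPoenaru_diffeoExtends_of_isOrientationPreserving.{0}` along
`ULift.{u}`: the manifold structure, compactness, connectedness, Hausdorffness and second
countability (`ManifoldULift.lean`, Mathlib), the handle decomposition of type `(1, p)`
(`ManifoldULift.hasHandleDecomposition`), orientability (`ManifoldULift.isOrientable`), the
boundary datum (`BoundaryData.ulift`: carrier `ULift ∂V₀`, inclusion `up ∘ incl ∘ down`) and the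
base point `up z₀`.  Given a self-diffeomorphism `ψ₁` of `ULift ∂V₀` preserving every
orientation, fixing `up z₀` and acting trivially on `π₁(ULift ∂V₀, up z₀)`, its conjugate
`ψ₀ = down ∘ ψ₁ ∘ up` preserves every orientation of `∂V₀`
(`Diffeomorph.isOrientationPreserving_conj_of_forall`), fixes `z₀` and acts trivially on
`π₁(∂V₀, z₀)` (`FundamentalGroup.mapOfEq_conj` along the homeomorphism `ULift ∂V₀ ≃ₜ ∂V₀`,
Hatcher (2002), §1.1, p. 34), so it extends over `V₀` by THMAᴹ`.{0}`; the extension lifts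
(`BoundaryData.DiffeoExtends.ulift`) to one of `up ∘ ψ₀ ∘ down = ψ₁` over `ULift V₀`.
Cf. Laudenbach–Poénaru (1972), §2, proof of Thm. A, pp. 341–342. [folklore] -/
theorem exists_oneHandlebody_laudenbachPoenaru_diffeoExtends_of_isOrientationPreserving_ulift
    (hT : exists_oneHandlebody_laudenbachPoenaru_diffeoExtends_of_isOrientationPreserving.{0}) :
    exists_oneHandlebody_laudenbachPoenaru_diffeoExtends_of_isOrientationPreserving.{u} := by
  intro p
  obtain ⟨V₀, _, _, _, _, _, _, _, b₀, z₀, hk₀, ho₀, hT₀⟩ := hT p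
  set D : ULift.{u} b₀.carrier ≃ₘ⟮𝓡 3, 𝓡 3⟯ b₀.carrier :=
    ManifoldULift.diffeomorph (𝓡 3) b₀.carrier ∞ with hD
  refine ⟨ULift.{u} V₀, inferInstance, inferInstance, inferInstance, inferInstance, inferInstance,
    inferInstance, inferInstance, b₀.ulift, ULift.up z₀,
    ManifoldULift.hasHandleDecomposition hk₀, ManifoldULift.isOrientable ho₀, ?_⟩
  intro ψ₁ hop₁ hz₁ hπ₁
  -- pull the diffeomorphism down to the universe-`0` boundary: `ψ₀ = down ∘ ψ₁ ∘ up`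
  set ψ₀ : b₀.carrier ≃ₘ⟮𝓡 3, 𝓡 3⟯ b₀.carrier := (D.symm.trans ψ₁).trans D with hψ₀
  have hψ₀_apply : ∀ x, ψ₀ x = ULift.down (ψ₁ (ULift.up x)) := fun x => rfl
  have hψ₀z : ψ₀ z₀ = z₀ := by rw [hψ₀_apply, hz₁]
  have hop₀ : ∀ o₀ : SmoothOrientation (𝓡 3) b₀.carrier, ψ₀.IsOrientationPreserving o₀ o₀ :=
    Diffeomorph.isOrientationPreserving_conj_of_forall D hop₁
  have hπ₀ : ∀ a₀ : FundamentalGroup b₀.carrier z₀,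
      FundamentalGroup.mapOfEq (⟨ψ₀, ψ₀.continuous⟩ : C(b₀.carrier, b₀.carrier)) hψ₀z a₀ = a₀ := by
    intro a₀
    -- conjugate by the homeomorphism `ULift ∂V₀ ≃ₜ ∂V₀`, based at `down (up z₀) = z₀`
    set e : (b₀.ulift : BoundaryData (𝓡∂ 4) (ULift.{u} V₀) (𝓡 3)).carrier ≃ₜ b₀.carrier :=
      Homeomorph.ulift with he
    set eπ := Homeomorph.fundamentalGroupCongr e (rfl : e (ULift.up z₀) = z₀) with heπ
    obtain ⟨a, rfl⟩ := eπ.surjective a₀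
    have key := FundamentalGroup.mapOfEq_conj e (rfl : e (ULift.up z₀) = z₀)
      (⟨ψ₁, ψ₁.continuous⟩ :
        C((b₀.ulift : BoundaryData (𝓡∂ 4) (ULift.{u} V₀) (𝓡 3)).carrier,
          (b₀.ulift : BoundaryData (𝓡∂ 4) (ULift.{u} V₀) (𝓡 3)).carrier))
      (⟨ψ₀, ψ₀.continuous⟩ : C(b₀.carrier, b₀.carrier)) hz₁ hψ₀z (fun q => rfl) a
    rw [hπ₁] at key
    exact key
  -- THMAᴹ in universe `0`, then push the extension up again
  have hext₀ : b₀.DiffeoExtends ψ₀ := hT₀ ψ₀ hop₀ hψ₀z hπ₀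
  have hext₁ : (b₀.ulift : BoundaryData (𝓡∂ 4) (ULift.{u} V₀) (𝓡 3)).DiffeoExtends
      (b₀.uliftDiffeo.{0, u} ψ₀) := hext₀.ulift
  have heq : b₀.uliftDiffeo.{0, u} ψ₀ = ψ₁ := Diffeomorph.ext fun x => rfl
  rw [heq] at hext₁
  exact hext₁

/-! ### §3 h₂ and the full extension fact from THMAᴹ in universe `0` -/

/-- **h₂ from NORM, UNIQ₄ and THMAᴹ in universe `0`** (every universe): with the bridge
`exists_oneHandlebody_laudenbachPoenaru_diffeoExtends_of_isOrientationPreserving_ulift`, the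
reduction `laudenbachPoenaru_diffeoExtends_of_isOrientationPreserving_of_model`
(`SPC4HandlesModelReduction.lean`) needs the model case only for the universe-`0` models.
Laudenbach–Poénaru (1972), proof of Thm. A with Kosinski (1993), VI (11.4)(c).
[cite: LaudenbachPoenaruBSMF1972, §2, proof of Thm. A, pp. 341–342]
[cite: Kosinski1993, VI (11.4)(c)] -/
theorem laudenbachPoenaru_diffeoExtends_of_isOrientationPreserving_of_model_zero
    (hN : exists_hasHandleDecomposition_handleCount_one.{u})
    (hU : nonempty_diffeomorph_of_hasHandleDecomposition_handleCount_one.{u})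
    (hT : exists_oneHandlebody_laudenbachPoenaru_diffeoExtends_of_isOrientationPreserving.{0}) :
    laudenbachPoenaru_diffeoExtends_of_isOrientationPreserving.{u} :=
  laudenbachPoenaru_diffeoExtends_of_isOrientationPreserving_of_model hN hU
    (exists_oneHandlebody_laudenbachPoenaru_diffeoExtends_of_isOrientationPreserving_ulift hT)

/-- **h₂ from the current leaves of its proof DAG**: Milnor's First Cancellation Theorem 5.4 on
a slab (`Cobordism.Milnor1965_firstCancellation_slab`, giving NORM by
`exists_hasHandleDecomposition_handleCount_one_of_firstCancellation`), the uniqueness of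
attaching one `1`-handle L1 (`oneHandle_nonempty_diffeomorph`, giving UNIQ₄ by
`nonempty_diffeomorph_of_hasHandleDecomposition_handleCount_one_of_oneHandle`) and THMAᴹ in
universe `0` imply `laudenbachPoenaru_diffeoExtends_of_isOrientationPreserving` in every
universe. [cite: LaudenbachPoenaruBSMF1972, §2, proof of Thm. A, pp. 341–342]
[cite: MilnorHCobordism1965, Thm. 5.4 and proof of Thm. 8.1] [cite: Kosinski1993, VI (11.4)(c)] -/
theorem laudenbachPoenaru_diffeoExtends_of_isOrientationPreserving_of_leaves
    (h54 : Cobordism.Milnor1965_firstCancellation_slab.{u})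
    (h₁ : oneHandle_nonempty_diffeomorph.{u})
    (hT : exists_oneHandlebody_laudenbachPoenaru_diffeoExtends_of_isOrientationPreserving.{0}) :
    laudenbachPoenaru_diffeoExtends_of_isOrientationPreserving.{u} :=
  laudenbachPoenaru_diffeoExtends_of_isOrientationPreserving_of_model_zero
    (exists_hasHandleDecomposition_handleCount_one_of_firstCancellation h54)
    (nonempty_diffeomorph_of_hasHandleDecomposition_handleCount_one_of_oneHandle h₁) hT

/-- **Laudenbach–Poénaru's extension theorem from its five current leaves, THMAᴹ taken in
universe `0`**: `exists_diffeomorph_comp_incl_eq_of_leaves` (`SPC4HandlesLeaves.lean`) with the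
bridge `exists_oneHandlebody_laudenbachPoenaru_diffeoExtends_of_isOrientationPreserving_ulift`.
[cite: LaudenbachPoenaruBSMF1972, §2, Lemma 2 and proof of Thm. A]
[cite: MilnorHCobordism1965, Thm. 5.4 and proof of Thm. 8.1] [cite: Kosinski1993, VI (11.4)(c)] -/
theorem exists_diffeomorph_comp_incl_eq_of_leaves_zero
    (h54 : Cobordism.Milnor1965_firstCancellation_slab.{u})
    (h₁ : oneHandle_nonempty_diffeomorph.{u})
    (hN : autFreeGroup_eq_closure_nielsen)
    (hR : exists_oneHandlebody_realise_laudenbachPoenaruGenerators.{u})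
    (hA : exists_oneHandlebody_laudenbachPoenaru_diffeoExtends_of_isOrientationPreserving.{0}) :
    exists_diffeomorph_comp_incl_eq.{u} :=
  exists_diffeomorph_comp_incl_eq_of_leaves h54 h₁ hN hR
    (exists_oneHandlebody_laudenbachPoenaru_diffeoExtends_of_isOrientationPreserving_ulift hA)

/-! ### §4 NORM discharged: h₂ from UNIQ₄ (or L1) and THMAᴹ in universe `0` -/

/-- **h₂ from UNIQ₄ and THMAᴹ in universe `0`** (every universe): NORM being the theorem
`exists_hasHandleDecomposition_handleCount_one_holds` (`SPC4HandlesNormHolds.lean`; Juhász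
(2023), §6.1 with Milnor (1965), Thm. 5.4), the reduction
`laudenbachPoenaru_diffeoExtends_of_isOrientationPreserving_of_model_zero` needs only the
classification UNIQ₄ (`nonempty_diffeomorph_of_hasHandleDecomposition_handleCount_one`;
Kosinski (1993), VI (11.4)(c)) and the model case THMAᴹ for the universe-`0` models.
[cite: LaudenbachPoenaruBSMF1972, §2, proof of Thm. A, pp. 341–342]
[cite: Kosinski1993, VI (11.4)(c)] -/
theorem laudenbachPoenaru_diffeoExtends_of_isOrientationPreserving_of_uniq_of_model_zero
    (hU : nonempty_diffeomorph_of_hasHandleDecomposition_handleCount_one.{u})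
    (hT : exists_oneHandlebody_laudenbachPoenaru_diffeoExtends_of_isOrientationPreserving.{0}) :
    laudenbachPoenaru_diffeoExtends_of_isOrientationPreserving.{u} :=
  laudenbachPoenaru_diffeoExtends_of_isOrientationPreserving_of_model_zero
    exists_hasHandleDecomposition_handleCount_one_holds hU hT

/-- **h₂ from its two remaining leaves, L1 and THMAᴹ in universe `0`**: the uniqueness of
attaching one `1`-handle L1 (`oneHandle_nonempty_diffeomorph`; Kosinski (1993), VI (6.6),
(11.4)(c)) gives UNIQ₄ (`nonempty_diffeomorph_of_hasHandleDecomposition_handleCount_one_of_oneHandle`,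
`SPC4HandlesLeaves.lean`), NORM is discharged, and THMAᴹ lifts from universe `0`
(`exists_oneHandlebody_laudenbachPoenaru_diffeoExtends_of_isOrientationPreserving_ulift`).  The
discharge `laudenbachPoenaru_diffeoExtends_of_isOrientationPreserving_holds` is this theorem
applied to `oneHandle_nonempty_diffeomorph_holds` and a proof of THMAᴹ`.{0}` (Laudenbach–Poénaru
(1972), proof of Thm. A: Lemma 3, Laudenbach's isotopy of homotopic systems of `2`-spheres in
`#p S¹ × S²` ([1], §5) and Cerf's `Γ₄ = 0`), once those land.
[cite: LaudenbachPoenaruBSMF1972, §2, proof of Thm. A, pp. 341–342]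
[cite: Kosinski1993, VI (6.6), (11.4)(c)] -/
theorem laudenbachPoenaru_diffeoExtends_of_isOrientationPreserving_of_two_leaves
    (hL : oneHandle_nonempty_diffeomorph.{u})
    (hT : exists_oneHandlebody_laudenbachPoenaru_diffeoExtends_of_isOrientationPreserving.{0}) :
    laudenbachPoenaru_diffeoExtends_of_isOrientationPreserving.{u} :=
  laudenbachPoenaru_diffeoExtends_of_isOrientationPreserving_of_uniq_of_model_zero
    (nonempty_diffeomorph_of_hasHandleDecomposition_handleCount_one_of_oneHandle hL) hT

/-- **Laudenbach–Poénaru's extension theorem from its three remaining leaves, THMAᴹ taken in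
universe `0`**: `exists_diffeomorph_comp_incl_eq_of_three_leaves` (`SPC4HandlesNormHolds.lean`:
L1, REALISE and THMAᴹ`.{u}`, with NORM, SYMMᴹ and Nielsen's theorem discharged) composed with
the bridge `exists_oneHandlebody_laudenbachPoenaru_diffeoExtends_of_isOrientationPreserving_ulift`.
[cite: LaudenbachPoenaruBSMF1972, §2, Lemma 2 and proof of Thm. A (pp. 339–342)]
[cite: Kosinski1993, VI (6.6), (11.4)(c)] -/
theorem exists_diffeomorph_comp_incl_eq_of_three_leaves_zero
    (hL : oneHandle_nonempty_diffeomorph.{u})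
    (hR : exists_oneHandlebody_realise_laudenbachPoenaruGenerators.{u})
    (hA : exists_oneHandlebody_laudenbachPoenaru_diffeoExtends_of_isOrientationPreserving.{0}) :
    exists_diffeomorph_comp_incl_eq.{u} :=
  exists_diffeomorph_comp_incl_eq_of_three_leaves hL hR
    (exists_oneHandlebody_laudenbachPoenaru_diffeoExtends_of_isOrientationPreserving_ulift hA)

/-! ### §5 Conversely: THMAᴹ in every universe from h₂ in universe `0`

The reductions of §§3–4 go from the model statement THMAᴹ to the abstract statement h₂.  The
converse is immediate, because the tree already *has* compact connected orientable
`1`-handlebodies of every type `(1, p)` in universe `0` together with a boundary datum and a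
base point on the boundary: the models `{q(x, y) + z² + w² ≤ c} ⊂ ℝ⁴` of
`OneHandlebodySymmFour.lean`, packaged (with more data than needed here) in the discharged
universe-`0` fact `exists_oneHandlebody_diffeoExtends_isOrientationReversing_zero`.  Hence
h₂`.{0}` ⟹ THMAᴹ`.{0}` ⟹ THMAᴹ`.{u}` (§2), and with L1 also h₂`.{0}` ⟹ h₂`.{u}`: **THMAᴹ and h₂
are one and the same obligation modulo the `1`-handle lemma L1**, and a universe-`0` proof of
h₂ is enough.  (What that obligation contains is certified in `SPC4HandlesThmAImpliesCerf.lean`: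
already h₂`.{0}` at `V = 𝔻⁴` is Cerf's `Γ₄ = 0`.) -/

/-- **THMAᴹ in universe `0` from h₂ in universe `0`.**  For every `p` the tree's model
`1`-handlebody of type `(1, p)` in universe `0` (`{q(x, y) + z² + w² ≤ c} ⊂ ℝ⁴`,
`OneHandlebodySymmFour.lean`, through
`exists_oneHandlebody_diffeoExtends_isOrientationReversing_zero`) is a compact connected
orientable `4`-manifold with `HasHandleDecomposition 3 V₀ (handleCount 1 p)`,
hence a `1`-handlebody (`isHandlebodyOfIndexLE_one_of_hasHandleDecomposition_handleCount_one`),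
with a boundary datum `b₀` and a point `z₀ ∈ b₀.carrier`; h₂ applied to `(V₀, b₀, z₀)` is the
body of THMAᴹ at `p`.  Laudenbach–Poénaru (1972) prove exactly this model case (`Y_p`, p. 342).
[cite: LaudenbachPoenaruBSMF1972, §2, proof of Thm. A, pp. 341–342] -/
theorem exists_oneHandlebody_laudenbachPoenaru_diffeoExtends_of_isOrientationPreserving_zero_of_h₂
    (h₂ : laudenbachPoenaru_diffeoExtends_of_isOrientationPreserving.{0}) :
    exists_oneHandlebody_laudenbachPoenaru_diffeoExtends_of_isOrientationPreserving.{0} := by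
  intro p
  obtain ⟨V₀, _, _, _, _, _, _, _, b₀, -, hk₀, ho₀, -, -, z₀, -, -⟩ :=
    exists_oneHandlebody_diffeoExtends_isOrientationReversing_zero p
  exact ⟨V₀, inferInstance, inferInstance, inferInstance, inferInstance, inferInstance,
    inferInstance, inferInstance, b₀, z₀, hk₀, ho₀, fun ψ hop hz hπ =>
      h₂ V₀ (isHandlebodyOfIndexLE_one_of_hasHandleDecomposition_handleCount_one hk₀) ho₀ b₀ ψ
        hop z₀ hz hπ⟩

/-- **THMAᴹ in every universe from h₂ in universe `0`**
(`exists_oneHandlebody_laudenbachPoenaru_diffeoExtends_of_isOrientationPreserving_zero_of_h₂`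
and the bridge of §2). [cite: LaudenbachPoenaruBSMF1972, §2, proof of Thm. A, pp. 341–342] -/
theorem exists_oneHandlebody_laudenbachPoenaru_diffeoExtends_of_isOrientationPreserving_of_h₂
    (h₂ : laudenbachPoenaru_diffeoExtends_of_isOrientationPreserving.{0}) :
    exists_oneHandlebody_laudenbachPoenaru_diffeoExtends_of_isOrientationPreserving.{u} :=
  exists_oneHandlebody_laudenbachPoenaru_diffeoExtends_of_isOrientationPreserving_ulift
    (exists_oneHandlebody_laudenbachPoenaru_diffeoExtends_of_isOrientationPreserving_zero_of_h₂ h₂)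

/-- **h₂ in every universe from h₂ in universe `0` and L1**: a universe-`0` discharge of
`laudenbachPoenaru_diffeoExtends_of_isOrientationPreserving` suffices
(`…_of_two_leaves` of §4 with `…_zero_of_h₂`).
[cite: LaudenbachPoenaruBSMF1972, §2, proof of Thm. A, pp. 341–342]
[cite: Kosinski1993, VI (6.6), (11.4)(c)] -/
theorem laudenbachPoenaru_diffeoExtends_of_isOrientationPreserving_of_oneHandle_of_zero
    (hL : oneHandle_nonempty_diffeomorph.{u})
    (h₂ : laudenbachPoenaru_diffeoExtends_of_isOrientationPreserving.{0}) :
    laudenbachPoenaru_diffeoExtends_of_isOrientationPreserving.{u} :=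
  laudenbachPoenaru_diffeoExtends_of_isOrientationPreserving_of_two_leaves hL
    (exists_oneHandlebody_laudenbachPoenaru_diffeoExtends_of_isOrientationPreserving_zero_of_h₂ h₂)

/-! ### §6 L1 discharged: h₂ is Thm. A on the models, unconditionally

The uniqueness of attaching one `1`-handle L1 is now the theorem
`oneHandle_nonempty_diffeomorph_holds` (`OneHandleStepExists.lean`; Milnor (1965), Thm. 3.13,
Kosinski (1993), VI (6.4), (7.1)), so UNIQ₄ holds
(`nonempty_diffeomorph_of_hasHandleDecomposition_handleCount_one_of_oneHandle`), NORM holds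
(`exists_hasHandleDecomposition_handleCount_one_holds`), and the universe-`u` models exist
(`exists_oneHandlebody_diffeoExtends_isOrientationReversing_holds`, `SPC4HandlesSymmHolds.lean`).
Hence the reductions of §§3–5 lose all their side hypotheses: **h₂ and THMAᴹ are equivalent in
every universe, and either follows from THMAᴹ (or h₂) in universe `0`.**  What is left of
Laudenbach–Poénaru's Théorème A (orientation-preserving, `π₁`-trivial case) in the tree is
therefore precisely its proof on `Y_p = ♮p S¹ × B³` (pp. 341–342: Lemma 3, Laudenbach's
isotopy theorem for homotopic systems of `2`-spheres in `#p S¹ × S²` ([1], §5, 5.3–5.4) and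
Cerf's `Γ₄ = 0`; the case `p = 0` *is* `Γ₄ = 0`, `SPC4HandlesThmAImpliesCerf.lean`). -/

/-- **h₂ from THMAᴹ, same universe, no further hypothesis**: the reduction
`laudenbachPoenaru_diffeoExtends_of_isOrientationPreserving_of_model`
(`SPC4HandlesModelReduction.lean`) fed with the discharged NORM
(`exists_hasHandleDecomposition_handleCount_one_holds`) and UNIQ₄ from the discharged L1
(`nonempty_diffeomorph_of_hasHandleDecomposition_handleCount_one_of_oneHandle
oneHandle_nonempty_diffeomorph_holds`).  Laudenbach–Poénaru (1972), p. 342: the general `V`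
is `Y_p` up to diffeomorphism. [cite: LaudenbachPoenaruBSMF1972, §2, proof of Thm. A, pp. 341–342]
[cite: Kosinski1993, VI (6.6), (11.4)(c)] -/
theorem laudenbachPoenaru_diffeoExtends_of_isOrientationPreserving_of_oneHandlebody
    (hT : exists_oneHandlebody_laudenbachPoenaru_diffeoExtends_of_isOrientationPreserving.{u}) :
    laudenbachPoenaru_diffeoExtends_of_isOrientationPreserving.{u} :=
  laudenbachPoenaru_diffeoExtends_of_isOrientationPreserving_of_model
    exists_hasHandleDecomposition_handleCount_one_holds
    (nonempty_diffeomorph_of_hasHandleDecomposition_handleCount_one_of_oneHandle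
      oneHandle_nonempty_diffeomorph_holds) hT

/-- **h₂ in every universe from THMAᴹ in universe `0`, no further hypothesis**
(`laudenbachPoenaru_diffeoExtends_of_isOrientationPreserving_of_two_leaves` with
`oneHandle_nonempty_diffeomorph_holds`).  The discharge
`laudenbachPoenaru_diffeoExtends_of_isOrientationPreserving_holds` is this theorem applied to a
proof of THMAᴹ`.{0}`. [cite: LaudenbachPoenaruBSMF1972, §2, proof of Thm. A, pp. 341–342]
[cite: Kosinski1993, VI (6.6), (11.4)(c)] -/
theorem laudenbachPoenaru_diffeoExtends_of_isOrientationPreserving_of_oneHandlebody_zero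
    (hT : exists_oneHandlebody_laudenbachPoenaru_diffeoExtends_of_isOrientationPreserving.{0}) :
    laudenbachPoenaru_diffeoExtends_of_isOrientationPreserving.{u} :=
  laudenbachPoenaru_diffeoExtends_of_isOrientationPreserving_of_two_leaves
    oneHandle_nonempty_diffeomorph_holds hT

/-- **h₂ in every universe from h₂ in universe `0`, no further hypothesis**
(`laudenbachPoenaru_diffeoExtends_of_isOrientationPreserving_of_oneHandle_of_zero` with
`oneHandle_nonempty_diffeomorph_holds`): a universe-`0` discharge of h₂ suffices.
[cite: LaudenbachPoenaruBSMF1972, §2, proof of Thm. A, pp. 341–342]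
[cite: Kosinski1993, VI (6.6), (11.4)(c)] -/
theorem laudenbachPoenaru_diffeoExtends_of_isOrientationPreserving_of_zero
    (h₂ : laudenbachPoenaru_diffeoExtends_of_isOrientationPreserving.{0}) :
    laudenbachPoenaru_diffeoExtends_of_isOrientationPreserving.{u} :=
  laudenbachPoenaru_diffeoExtends_of_isOrientationPreserving_of_oneHandle_of_zero
    oneHandle_nonempty_diffeomorph_holds h₂

/-- **THMAᴹ from h₂, same universe**: as
`exists_oneHandlebody_laudenbachPoenaru_diffeoExtends_of_isOrientationPreserving_zero_of_h₂`,
with the universe-`u` models of the discharged fact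
`exists_oneHandlebody_diffeoExtends_isOrientationReversing_holds` (`SPC4HandlesSymmHolds.lean`:
the lifts `ULift {q(x, y) + z² + w² ≤ c}` with their handle decompositions of type `(1, p)`,
boundary data and base points). [cite: LaudenbachPoenaruBSMF1972, §2, proof of Thm. A, pp. 341–342] -/
theorem exists_oneHandlebody_laudenbachPoenaru_diffeoExtends_of_isOrientationPreserving_of_h₂'
    (h₂ : laudenbachPoenaru_diffeoExtends_of_isOrientationPreserving.{u}) :
    exists_oneHandlebody_laudenbachPoenaru_diffeoExtends_of_isOrientationPreserving.{u} := by
  intro p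
  obtain ⟨V₀, _, _, _, _, _, _, _, b₀, -, hk₀, ho₀, -, -, z₀, -, -⟩ :=
    exists_oneHandlebody_diffeoExtends_isOrientationReversing_holds.{u} p
  exact ⟨V₀, inferInstance, inferInstance, inferInstance, inferInstance, inferInstance,
    inferInstance, inferInstance, b₀, z₀, hk₀, ho₀, fun ψ hop hz hπ =>
      h₂ V₀ (isHandlebodyOfIndexLE_one_of_hasHandleDecomposition_handleCount_one hk₀) ho₀ b₀ ψ
        hop z₀ hz hπ⟩

/-- **h₂ ↔ THMAᴹ in every universe, unconditionally**: the orientation-preserving,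
`π₁`-trivial case of Laudenbach–Poénaru's Théorème A for all compact connected orientable
`4`-dimensional `1`-handlebodies is equivalent to the same statement on one model of each type
`(1, p)` (`laudenbachPoenaru_diffeoExtends_of_isOrientationPreserving_of_oneHandlebody`,
`exists_oneHandlebody_laudenbachPoenaru_diffeoExtends_of_isOrientationPreserving_of_h₂'`).
[cite: LaudenbachPoenaruBSMF1972, §2, proof of Thm. A, pp. 341–342]
[cite: Kosinski1993, VI (6.6), (11.4)(c)] -/
theorem laudenbachPoenaru_diffeoExtends_of_isOrientationPreserving_iff_oneHandlebody :
    laudenbachPoenaru_diffeoExtends_of_isOrientationPreserving.{u} ↔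
      exists_oneHandlebody_laudenbachPoenaru_diffeoExtends_of_isOrientationPreserving.{u} :=
  ⟨exists_oneHandlebody_laudenbachPoenaru_diffeoExtends_of_isOrientationPreserving_of_h₂',
    laudenbachPoenaru_diffeoExtends_of_isOrientationPreserving_of_oneHandlebody⟩

end Literature.Topology.FourManifolds
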